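import Summits.Langlands.Langlands.Theorems.PhantomRMYoshidaStableYoshidaCongruenceOrdinaryFrameFp
import Summits.Langlands.Langlands.Theorems.PhantomRMYoshidaResiduallyYoshidaLiftingGreenbergPlane
import HarnessLib

/-!
# INERTIA-FIXED VECTORS LIE IN THE WEIGHT-`0` PLANE (stub `stub_inertiaFixedInOrdinaryPlane`, PD-a) — line
# `sector-klingen-split`, crux `ResiduallyYoshidaLifting` (stmt-Langlands-13639)

Stub-worker of lead prover-line-stmt-Langlands-13639-c5-0 (continuation c5, skeleton rev 14, sub-goal PD-a, 2026-08-17).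

**Theorem (`stub_inertiaFixedInOrdinaryPlane`, registered signature verbatim).**  Let `v ∣ p` (`p ≠ 2`) and let
`ρ : Γ_{ℚ_v} → GL₄(ℚ̄_p)` admit a frame `g` such that every `A_τ := g ρ(τ) g⁻¹` is upper triangular and, for `τ` in
the inertia group `I_v`, has diagonal `(1, 1, ε(τ)⁻¹, ε(τ)⁻¹)` (the first two clauses of the Greenberg / crystalline
ordinary shape `(0,0,1,1)`).  Then every inertia-fixed vector `w` lies in the weight-`0` plane `g⁻¹⟨e₀, e₁⟩`:
`(g w)₂ = (g w)₃ = 0`.  In particular the Greenberg plane of `stub_greenbergPlane` is UNIQUE.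

**Proof.**  Put `u := g w`; for `τ ∈ I_v`, `A_τ u = g ρ(τ) w = g w = u`.  Choose `τ₀ ∈ I_v` with `ε(τ₀) = -1`
(`χ_p(I_{ℚ_v}) = ℤ_pˣ`, tree `adicCompletion_rat_exists_mem_absInertia_cyclotomicCharacter_eq`), so the diagonal of
`A_{τ₀}` is `(1, 1, -1, -1)`.  Row `3` of `A_{τ₀} u = u` reads `-u₃ = u₃`, so `u₃ = 0` (`char ℚ̄_p = 0`); row `2` then
reads `-u₂ + (A_{τ₀})₂₃ u₃ = u₂`, so `u₂ = 0`.  No new definitions, no named fact taken as a hypothesis.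
-/

noncomputable section

-- `Summit.Langlands.Langlands.…` (summit = sub-problem name, D-0017 layout) trips `dupNamespace` on every decl.
set_option linter.dupNamespace false
set_option autoImplicit false

open IsDedekindDomain
open scoped Matrix
open Literature.NumberTheory.GaloisRepresentations

namespace Summit.Langlands.Langlands.Cruxes.ResiduallyYoshidaLifting.SectorKlingenSplit.Fibre

/-- Rows `2, 3` of a fixed vector of an upper triangular `4 × 4` matrix whose last two diagonal entries are `-1`
vanish (over a domain of characteristic `0`). [folklore] -/
private theorem apply_two_three_eq_zero_of_upperTriangular_mulVec_eq {R : Type*} [CommRing R] [NoZeroDivisors R]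
    [CharZero R] (M : Matrix (Fin 4) (Fin 4) R) (u : Fin 4 → R)
    (h20 : M 2 0 = 0) (h21 : M 2 1 = 0) (h22 : M 2 2 = -1)
    (h30 : M 3 0 = 0) (h31 : M 3 1 = 0) (h32 : M 3 2 = 0) (h33 : M 3 3 = -1)
    (hfix : M *ᵥ u = u) : u 2 = 0 ∧ u 3 = 0 := by
  have e3 := congrFun hfix 3
  have e2 := congrFun hfix 2
  simp only [Matrix.mulVec, dotProduct, Fin.sum_univ_four, h30, h31, h32, h33, zero_mul, zero_add,
    neg_one_mul] at e3
  have hu3 : u 3 = 0 := CharZero.neg_eq_self_iff.1 e3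
  simp only [Matrix.mulVec, dotProduct, Fin.sum_univ_four, h20, h21, h22, hu3, zero_mul, zero_add,
    mul_zero, add_zero, neg_one_mul] at e2
  exact ⟨CharZero.neg_eq_self_iff.1 e2, hu3⟩

/-- **Registered statement `stub_inertiaFixedInOrdinaryPlane`** (PD-a; THE GREENBERG PLANE IS UNIQUE).  Let
`ρ : Γ_{ℚ_v} → GL₄(ℚ̄_p)` (`v ∣ p`, `p ≠ 2`) admit a frame `g` which is upper triangular on `Γ_{ℚ_v}` with inertial
diagonal `(1, 1, ε⁻¹, ε⁻¹)` (the first two clauses of the crystalline/Greenberg shape `(0,0,1,1)`).  Then EVERY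
inertia-fixed vector lies in the weight-`0` plane `g⁻¹⟨e₀, e₁⟩`: its last two coordinates in the frame vanish
(inertia acts on the quotient by the plane through a triangular matrix with both diagonal entries `ε(τ)⁻¹`, and
`ε(τ₀) = -1 ≠ 1` for some `τ₀ ∈ I_v`, `adicCompletion_rat_exists_mem_absInertia_cyclotomicCharacter_eq`). [folklore] -/
theorem stub_inertiaFixedInOrdinaryPlane :
    ∀ (p : ℕ) [Fact p.Prime], p ≠ 2 → ∀ (v : HeightOneSpectrum (NumberField.RingOfIntegers ℚ)),
      ((p : ℕ) : NumberField.RingOfIntegers ℚ) ∈ v.asIdeal →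
      ∀ (ρ : FramedRep (Field.absoluteGaloisGroup (v.adicCompletion ℚ)) (PadicAlgCl p) 4) (g : GL (Fin 4) (PadicAlgCl p)),
      (∀ (τ : Field.absoluteGaloisGroup (v.adicCompletion ℚ)) (i j : Fin 4), j < i →
        ((g * ρ τ * g⁻¹ : GL (Fin 4) (PadicAlgCl p)) : Matrix (Fin 4) (Fin 4) (PadicAlgCl p)) i j = 0) →
      (∀ τ ∈ absInertia (v.adicCompletion ℚ), ∀ i : Fin 4,
        ((g * ρ τ * g⁻¹ : GL (Fin 4) (PadicAlgCl p)) : Matrix (Fin 4) (Fin 4) (PadicAlgCl p)) i i =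
          algebraMap ℚ_[p] (PadicAlgCl p)
            ((((GaloisRep.cyclotomicCharacter (v.adicCompletion ℚ) p τ)⁻¹ : ℤ_[p]ˣ) : ℤ_[p]) : ℚ_[p]) ^ (![0, 0, 1, 1] i : ℕ)) →
      ∀ w : Fin 4 → PadicAlgCl p, (∀ τ ∈ absInertia (v.adicCompletion ℚ), (ρ τ).val *ᵥ w = w) →
        (g.val *ᵥ w) 2 = 0 ∧ (g.val *ᵥ w) 3 = 0 := by
  intro p _ _hp v hv ρ g hup hdiag w hw
  -- an inertia element with cyclotomic character `-1`
  obtain ⟨τ₀, hτ₀I, hτ₀⟩ :=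
    adicCompletion_rat_exists_mem_absInertia_cyclotomicCharacter_eq p v
      (Summit.Langlands.Langlands.Cruxes.StableYoshidaCongruence.LevelThreeWeierstrassSwitch.primesEquiv_eq_of_natCast_mem
        p v hv) (-1)
  -- conjugation bookkeeping: `A g = g ρ(τ₀)` for `A = g ρ(τ₀) g⁻¹`, so `A (g w) = g w`
  have hMg : ((g * ρ τ₀ * g⁻¹ : GL (Fin 4) (PadicAlgCl p)) : Matrix (Fin 4) (Fin 4) (PadicAlgCl p)) * g.val =
      g.val * (ρ τ₀).val := by
    rw [← Units.val_mul, inv_mul_cancel_right, Units.val_mul]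
  have hfix : ((g * ρ τ₀ * g⁻¹ : GL (Fin 4) (PadicAlgCl p)) : Matrix (Fin 4) (Fin 4) (PadicAlgCl p)) *ᵥ
      (g.val *ᵥ w) = g.val *ᵥ w := by
    rw [Matrix.mulVec_mulVec, hMg, ← Matrix.mulVec_mulVec, hw τ₀ hτ₀I]
  set M : Matrix (Fin 4) (Fin 4) (PadicAlgCl p) :=
    ((g * ρ τ₀ * g⁻¹ : GL (Fin 4) (PadicAlgCl p)) : Matrix (Fin 4) (Fin 4) (PadicAlgCl p)) with hM
  -- the diagonal entries `M₂₂ = M₃₃ = ι((-1)⁻¹) ^ 1 = -1`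
  have hval : ∀ i : Fin 4, (![0, 0, 1, 1] i : ℕ) = 1 → M i i = -1 := fun i hi => by
    rw [hM, hdiag τ₀ hτ₀I i, hτ₀, hi,
      Summit.Langlands.Langlands.Cruxes.StableYoshidaCongruence.LevelThreeWeierstrassSwitch.algebraMap_inv_neg_one_pow
        p 1, pow_one]
  have h22 : M 2 2 = -1 := hval 2 rfl
  have h33 : M 3 3 = -1 := hval 3 rfl
  have h20 : M 2 0 = 0 := hup τ₀ 2 0 (by decide)
  have h21 : M 2 1 = 0 := hup τ₀ 2 1 (by decide)
  have h30 : M 3 0 = 0 := hup τ₀ 3 0 (by decide)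
  have h31 : M 3 1 = 0 := hup τ₀ 3 1 (by decide)
  have h32 : M 3 2 = 0 := hup τ₀ 3 2 (by decide)
  exact apply_two_three_eq_zero_of_upperTriangular_mulVec_eq M (g.val *ᵥ w) h20 h21 h22 h30 h31 h32 h33
    hfix

end Summit.Langlands.Langlands.Cruxes.ResiduallyYoshidaLifting.SectorKlingenSplit.Fibre

end
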